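import Literature.NumberTheory.LFunctions.ProlateEigenvalueLegendreBounds
import Mathlib.Analysis.SpecialFunctions.Sqrt
import Mathlib.Analysis.SpecialFunctions.Trigonometric.Deriv
import Mathlib.MeasureTheory.Integral.IntervalIntegral.FundThmCalculus
import HarnessLib

/-!
# Osipov's bound `χ_n(c) < (π(n+1)/2)²` for prolate eigenvalues with `χ_n(c) > c²` — PROVED

LINE 1 — FRAMING. RH-FREE corpus literature (special functions: prolate spheroidal wave functions on
`[−1, 1]`); bears_on: LADDER-RH W-C/W-P only through the insurance fact `BonamiKaroui2014_eq_4`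
(`ProlateEndpointBounds.lean`, cell rh-crit GAP G-cc-25), whose printed proof quotes this bound.
WHAT THIS IS NOT: any claim about RH; nothing here bears on the truth of RH.

## The result

For a bandwidth `c ≥ 0`, let `ψ` be a real `C¹([−1,1])` solution of the prolate equation
`((1 − t²) ψ′)′ + (χ − c² t²) ψ = 0` on `(−1, 1)` with exactly `n` zeros in `(−1, 1)` (in Lean: the
abstract hypotheses `ψ, ψ₁` continuous on `[−1,1]`, `ψ′ = ψ₁` and `((1−t²)ψ₁)′ = −χ(1 − q t²)ψ` on
`(−1,1)`, `q = c²/χ`).  **Osipov's theorem** [Osipov 2013, Thm. 8 = Osipov 2012 (report), Thm. 13]: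
if `χ > c²` (i.e. `q < 1`) then

  `χ < (π (n + 1) / 2)²`.

Printed for `n ≥ 2` and the PSWF `ψ_n`; proved here for every `n ≥ 0` (`chi_lt_of_isUnitPSWF`), and
transported to the tree's prolate functions `IsProlateFunction lam n f` (`ConnesProlateGuess.lean`:
`−((λ² − x²) f′)′ + (2πλx)² f = χ f` on `(−λ, λ)`, bandwidth `c = 2πλ²` after `x = λt`) as
`IsProlateFunction.eigen_lt_sq_of_sq_lt_eigen : (2πλ²)² < χ → χ < (π(n+1)/2)²`.

## Proof (Liouville normal form + Sturm comparison; deviation from print recorded)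

The printed proof (report, Thm. 13) combines the transformation `Ψ = √(1−t²) ψ`, `Ψ″ + Q_n Ψ = 0`,
`Q_n > χ + 1`, Sturm's spacing bound for the largest zero `t_n ≥ 1 − π/√(χ+1)` and the sharp
Prüfer-angle inequality `n > 1 + (2/π)∫_0^{t_n} √((χ − c²t²)/(1−t²)) dt` (report, Thm. (n_lower),
several pages).  We take the shorter classical road through the **Liouville normal form**: with
`p = 1 − t²`, `ρ = 1 − q t²`, `Q = pρ`, `w = Q^{1/4}`, `S′ = ρ / w² = √(ρ/p)`, the function
`U = w ψ` satisfies `U_{ss} + (χ + Θ) U = 0` in the variable `s = S(t)`, where the correction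
`Θ = Θ_q(t) = B_q(t) / (16 (1−t²)(1−qt²)³)`, `B_q(t) = 8(1+q) − 4(1+10q−3q²)t² + 8q(3−q)t⁴`
(`= (2 − t²)/(4(1 − t²))` at `q = 0`, Legendre) is POSITIVE on `(−1, 1)` for `0 ≤ q < 1`
(`theta_pos`).  Consequently the explicit function `G = sin(√χ S + φ) / w` solves
`((1−t²) G′)′ = −(χ − Θ) ρ G`, an equation with a potential pointwise ABOVE that of `ψ`; by Sturm's
comparison theorem (the tree's Wronskian argument `sturm_gap_pos_of_potential`, here on INTERIOR gaps,
`sturm_interior_gap`) every gap between consecutive zeros of `G` contains a zero of `ψ`.  Since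
`S′ = √(ρ/p) ≥ 1`, and `≥ 2` near the end points, `S` increases by MORE than `2` across `(−1, 1)`
(`exists_Sf_sub_Sf_gt_two`); if `√χ ≥ π(n+1)/2` the phase `√χ S` then increases by more than `(n+1)π`,
so `G` has `n + 2` consecutive zeros and `ψ` at least `n + 1` zeros — a contradiction.  All special
inputs are explicit: no elliptic integrals, no Prüfer angle.  (The same normal form, with `Θ′ ≥ 0` on
`[0,1)`, drives Bonami–Karoui's fundamental inequality in `ProlateEndpointBoundsProofs.lean`.)

## References

* A. Osipov, *Certain upper bounds on the eigenvalues associated with prolate spheroidal wave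
  functions*, Appl. Comput. Harmon. Anal. 35 (2013) 309–340 = arXiv:1206.4541, §2.1 Thm. 8
  (held text chunk p0005:L118–L129). [cite: Osipov2013, Thm. 8]
* A. Osipov, *Certain inequalities involving prolate spheroidal wave functions and associated
  quantities*, Appl. Comput. Harmon. Anal. (2013) = arXiv:1206.4056 (report), Thm. 13 with proof
  (held text chunk p0016:L41–L84). [cite: Osipov2012Inequalities, Thm. 13]
* P. Hartman, *Ordinary Differential Equations*, SIAM Classics 38 (2002), Ch. XI §3 Thm 3.1 (Sturm
  comparison) and §2 (Liouville normal form). [cite: Hartman2002, Ch. XI §3 Thm 3.1]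

Nothing in this file bears on the truth of the Riemann hypothesis.
-/

noncomputable section

open Real Set MeasureTheory Filter Topology intervalIntegral

namespace Literature.NumberTheory.LFunctions

namespace ProlateLiouville

/-! ## §1 The explicit functions of the Liouville normal form -/

/-- RH-FREE object. `ρ_q(t) = 1 − q t²` (the weight `(χ − c²t²)/χ`). [cite: BonamiKaroui2014, §2 proof of Prop. 2.1 p. 231] -/
def rho (q t : ℝ) : ℝ := 1 - q * t ^ 2

/-- RH-FREE object. `Q_q(t) = (1 − t²)(1 − q t²)`. [cite: BonamiKaroui2014, §3 p. 231 («Q_q»)] -/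
def Qf (q t : ℝ) : ℝ := (1 - t ^ 2) * (1 - q * t ^ 2)

/-- RH-FREE object. `Q_q′(t) = −2(1+q)t + 4qt³`. [cite: BonamiKaroui2014, §3 p. 231] -/
def dQ (q t : ℝ) : ℝ := -2 * (1 + q) * t + 4 * q * t ^ 3

/-- RH-FREE object. `Q_q″(t) = −2(1+q) + 12qt²`. [cite: BonamiKaroui2014, §3 p. 231] -/
def ddQ (q t : ℝ) : ℝ := -2 * (1 + q) + 12 * q * t ^ 2

/-- RH-FREE object. The logarithmic derivative of `Q^{1/4}`: `L = Q′/(4Q)`.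
[cite: Hartman2002, Ch. XI §2 (Liouville normal form)] -/
def Lf (q t : ℝ) : ℝ := dQ q t / (4 * Qf q t)

/-- RH-FREE object. The numerator `B_q(t) = 8(1+q) − 4(1+10q−3q²)t² + 8q(3−q)t⁴` of the Liouville
correction. [cite: Hartman2002, Ch. XI §2; BonamiKaroui2014, proof of Prop. 2.1 («θ∘S an explicit rational function»)] -/
def Bf (q t : ℝ) : ℝ := 8 * (1 + q) - 4 * (1 + 10 * q - 3 * q ^ 2) * t ^ 2 + 8 * q * (3 - q) * t ^ 4

/-- RH-FREE object. **The Liouville correction** `Θ_q(t) = B_q(t)/(16(1−t²)(1−qt²)³)`: in the variable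
`s = ∫√((1−qt²)/(1−t²))dt` the function `Q^{1/4}ψ` satisfies `U″ + (χ + Θ)U = 0`.
(`q = 0`: `Θ = (2−t²)/(4(1−t²))`, the classical normal form of Legendre's equation.)
[cite: Hartman2002, Ch. XI §2; BonamiKaroui2014, proof of Prop. 2.1 p. 231] -/
def theta (q t : ℝ) : ℝ := Bf q t / (16 * (1 - t ^ 2) * (1 - q * t ^ 2) ^ 3)

/-- RH-FREE object. The numerator `D_q(t)` of `Θ′ = t·D/(16(1−t²)²(1−qt²)⁴)`. [cite: Hartman2002, Ch. XI §2] -/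
def Df (q t : ℝ) : ℝ :=
  (8 - 16 * q + 72 * q ^ 2) + (16 * q - 256 * q ^ 2 + 48 * q ^ 3) * t ^ 2 +
    (-24 * q + 304 * q ^ 2 - 88 * q ^ 3) * t ^ 4 + (-96 * q ^ 2 + 32 * q ^ 3) * t ^ 6

/-- RH-FREE object. `Θ′` in closed form. [cite: Hartman2002, Ch. XI §2] -/
def dtheta (q t : ℝ) : ℝ := t * Df q t / (16 * (1 - t ^ 2) ^ 2 * (1 - q * t ^ 2) ^ 4)

section signs

variable {q t : ℝ}

/-- `1 − t² > 0` on `(−1, 1)`. [cite: BonamiKaroui2014, §3 p. 231 (the function `Q_q`)] -/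
theorem one_sub_sq_pos (ht : t ∈ Ioo (-1 : ℝ) 1) : 0 < 1 - t ^ 2 := by
  have : t ^ 2 < 1 := by nlinarith [ht.1, ht.2]
  linarith

/-- `ρ_q(t) > 0` on `(−1,1)` for `0 ≤ q ≤ 1`. [cite: BonamiKaroui2014, §3 p. 231 (the function `Q_q`)] -/
theorem rho_pos (hq1 : q ≤ 1) (ht : t ∈ Ioo (-1 : ℝ) 1) : 0 < rho q t := by
  have : t ^ 2 < 1 := by nlinarith [ht.1, ht.2]
  unfold rho; nlinarith

/-- `ρ_q ≤ 1` for `q ≥ 0`. [cite: BonamiKaroui2014, §3 p. 231 (the function `Q_q`)] -/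
theorem rho_le_one (hq : 0 ≤ q) : rho q t ≤ 1 := by
  unfold rho; nlinarith [sq_nonneg t]

/-- `Q_q = (1−t²)ρ_q`. [cite: BonamiKaroui2014, §3 p. 231 (the function `Q_q`)] -/
theorem Qf_eq : Qf q t = (1 - t ^ 2) * rho q t := rfl

/-- `Q_q(t) > 0` on `(−1,1)` for `0 ≤ q ≤ 1`. [cite: BonamiKaroui2014, §3 p. 231 (the function `Q_q`)] -/
theorem Qf_pos (hq1 : q ≤ 1) (ht : t ∈ Ioo (-1 : ℝ) 1) : 0 < Qf q t :=
  mul_pos (one_sub_sq_pos ht) (rho_pos hq1 ht)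

/-- `Q_q ≤ 1` on `(−1,1)` for `0 ≤ q ≤ 1`. [cite: BonamiKaroui2014, §3 p. 231 (the function `Q_q`)] -/
theorem Qf_le_one (hq : 0 ≤ q) (hq1 : q ≤ 1) (ht : t ∈ Ioo (-1 : ℝ) 1) : Qf q t ≤ 1 := by
  rw [Qf_eq]
  have h1 : 1 - t ^ 2 ≤ 1 := by nlinarith [sq_nonneg t]
  have h2 := rho_le_one (t := t) hq
  have h3 := (rho_pos hq1 ht).le
  nlinarith [sq_nonneg t]

/-- `B_q(t) ≥ 4(1−q)²` for `t² ≤ 1`, `0 ≤ q ≤ 1`: indeed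
`B = 4(1−q)² + (1−t²)((4+16q−4q²) − (24q−8q²)t²)`. [cite: Hartman2002, Ch. XI §2 (Liouville normal form); BonamiKaroui2014, proof of Prop. 2.1 p. 231] -/
theorem Bf_ge (hq : 0 ≤ q) (hq1 : q ≤ 1) (ht : t ^ 2 ≤ 1) : 4 * (1 - q) ^ 2 ≤ Bf q t := by
  have hu : 0 ≤ t ^ 2 := sq_nonneg t
  have key : Bf q t = 4 * (1 - q) ^ 2 +
      (1 - t ^ 2) * ((4 + 16 * q - 4 * q ^ 2) - (24 * q - 8 * q ^ 2) * t ^ 2) := by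
    unfold Bf; ring
  have h1 : 4 * (1 - q) ^ 2 ≤ (4 + 16 * q - 4 * q ^ 2) - (24 * q - 8 * q ^ 2) * t ^ 2 := by
    have : (24 * q - 8 * q ^ 2) * t ^ 2 ≤ (24 * q - 8 * q ^ 2) * 1 :=
      mul_le_mul_of_nonneg_left ht (by nlinarith)
    nlinarith
  rw [key]
  nlinarith [mul_nonneg (sub_nonneg.2 ht) (le_trans (by positivity) h1)]

/-- `B_q(t) > 0` on `t² ≤ 1` for `0 ≤ q < 1`. [cite: Hartman2002, Ch. XI §2 (Liouville normal form); BonamiKaroui2014, proof of Prop. 2.1 p. 231] -/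
theorem Bf_pos (hq : 0 ≤ q) (hq1 : q < 1) (ht : t ^ 2 ≤ 1) : 0 < Bf q t :=
  lt_of_lt_of_le (by nlinarith) (Bf_ge hq hq1.le ht)

/-- **`Θ_q > 0` on `(−1,1)`** for `0 ≤ q < 1`. [cite: Hartman2002, Ch. XI §2] -/
theorem theta_pos (hq : 0 ≤ q) (hq1 : q < 1) (ht : t ∈ Ioo (-1 : ℝ) 1) : 0 < theta q t := by
  have h1 := one_sub_sq_pos ht
  have h2 := rho_pos hq1.le ht
  unfold theta
  exact div_pos (Bf_pos hq hq1 (by nlinarith [ht.1, ht.2])) (by unfold rho at h2; positivity)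

/-- `Θ_q(0) = (1+q)/2`. [cite: Hartman2002, Ch. XI §2 (Liouville normal form); BonamiKaroui2014, proof of Prop. 2.1 p. 231] -/
theorem theta_zero : theta q 0 = (1 + q) / 2 := by
  unfold theta Bf; norm_num; ring

/-- `D_q(t) ≥ 0` for `t², q ∈ [0,1]`.  With `v = 1 − t²`, `r = 1 − q`:
`D/8 = r³ + 4r²qv − rq(4−r)v² + 4q²(r+2)v³ ≥ r³ + 4r²qv − 4rqv² + 8q²v³ ≥ 0`
(for `q ≥ 1/8`: `r² + 2qv² − rv = (r − v/2)² + (2q − ¼)v²`; for `q ≤ 1/8`: `r² ≥ 49/64 ≥ 4qv²`).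
[cite: Hartman2002, Ch. XI §2 (Liouville normal form); BonamiKaroui2014, proof of Prop. 2.1 p. 231] -/
theorem Df_nonneg (hq : 0 ≤ q) (hq1 : q ≤ 1) (ht : t ^ 2 ≤ 1) : 0 ≤ Df q t := by
  set v : ℝ := 1 - t ^ 2 with hv
  set r : ℝ := 1 - q with hr
  have hv0 : 0 ≤ v := by rw [hv]; linarith
  have hv1 : v ≤ 1 := by rw [hv]; nlinarith [sq_nonneg t]
  have hr0 : 0 ≤ r := by rw [hr]; linarith
  have key : Df q t = 8 * (r ^ 3 + 4 * r ^ 2 * q * v - r * q * (4 - r) * v ^ 2 +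
      4 * q ^ 2 * (r + 2) * v ^ 3) := by
    simp only [Df, hv, hr]; ring
  have step : r ^ 3 + 4 * r ^ 2 * q * v - 4 * r * q * v ^ 2 + 8 * q ^ 2 * v ^ 3 ≤
      r ^ 3 + 4 * r ^ 2 * q * v - r * q * (4 - r) * v ^ 2 + 4 * q ^ 2 * (r + 2) * v ^ 3 := by
    have h1 : 0 ≤ r * q * r * v ^ 2 := by positivity
    have h2 : 0 ≤ 4 * q ^ 2 * r * v ^ 3 := by positivity
    nlinarith
  rw [key]
  refine mul_nonneg (by norm_num) (le_trans ?_ step)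
  rcases le_or_gt (1 / 8 : ℝ) q with hq8 | hq8
  · -- `4r²qv + 8q²v³ − 4rqv² = 4qv((r − v/2)² + (2q − 1/4)v²) ≥ 0`
    have h1 : 0 ≤ 4 * q * v * ((r - v / 2) ^ 2 + (2 * q - 1 / 4) * v ^ 2) := by
      have : 0 ≤ (2 * q - 1 / 4) * v ^ 2 := mul_nonneg (by linarith) (sq_nonneg v)
      positivity
    nlinarith [pow_nonneg hr0 3]
  · -- `q < 1/8`: `r ≥ 7/8`, `r³ ≥ 4rqv²`
    have hr7 : 7 / 8 ≤ r := by rw [hr]; linarith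
    have h1 : 4 * r * q * v ^ 2 ≤ r ^ 3 := by
      have : q * v ^ 2 ≤ 1 / 8 * 1 := by
        have := mul_le_mul hq8.le (show v ^ 2 ≤ 1 by nlinarith) (sq_nonneg v) (by norm_num)
        linarith
      nlinarith [mul_nonneg hr0 hr0]
    nlinarith [mul_nonneg (mul_nonneg (sq_nonneg r) hq) hv0, mul_nonneg (sq_nonneg q) (pow_nonneg hv0 3)]

/-- **`Θ_q′ ≥ 0` on `[0, 1)`** for `0 ≤ q ≤ 1` (value of the closed form `dtheta`). [cite: BonamiKaroui2014, proof of Prop. 2.1 p. 231 («θ∘S increasing»)] -/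
theorem dtheta_nonneg (hq : 0 ≤ q) (hq1 : q ≤ 1) (ht0 : 0 ≤ t) (ht : t ∈ Ioo (-1 : ℝ) 1) :
    0 ≤ dtheta q t := by
  unfold dtheta
  have h2 := rho_pos hq1 ht
  unfold rho at h2
  exact div_nonneg (mul_nonneg ht0 (Df_nonneg hq hq1 (by nlinarith [ht.1, ht.2]))) (by positivity)

end signs

/-! ## §2 Derivatives and the two algebraic identities of the normal form -/

section derivs

variable {q t : ℝ}

/-- `Q′ = dQ`. [cite: BonamiKaroui2014, §3 p. 231 (the function `Q_q`)] -/
theorem hasDerivAt_Qf (q t : ℝ) : HasDerivAt (Qf q) (dQ q t) t := by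
  have h : HasDerivAt (fun y : ℝ ↦ (1 - y ^ 2) * (1 - q * y ^ 2))
      ((-(2 * t)) * (1 - q * t ^ 2) + (1 - t ^ 2) * (-(q * (2 * t)))) t := by
    have h1 : HasDerivAt (fun y : ℝ ↦ 1 - y ^ 2) (-(2 * t)) t := by
      simpa using (hasDerivAt_pow 2 t).const_sub 1
    have h2 : HasDerivAt (fun y : ℝ ↦ 1 - q * y ^ 2) (-(q * (2 * t))) t := by
      simpa using ((hasDerivAt_pow 2 t).const_mul q).const_sub 1
    exact h1.mul h2
  refine (h.congr_of_eventuallyEq (Eventually.of_forall fun y ↦ rfl)).congr_deriv ?_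
  unfold dQ; ring

/-- `ρ′ = −2qt`. [cite: BonamiKaroui2014, §3 p. 231 (the function `Q_q`)] -/
theorem hasDerivAt_rho (q t : ℝ) : HasDerivAt (rho q) (-(2 * q * t)) t := by
  have h : HasDerivAt (fun y : ℝ ↦ 1 - q * y ^ 2) (-(q * (2 * t))) t := by
    simpa using ((hasDerivAt_pow 2 t).const_mul q).const_sub 1
  exact (h.congr_of_eventuallyEq (Eventually.of_forall fun y ↦ rfl)).congr_deriv (by ring)

/-- `dQ′ = ddQ`. [cite: BonamiKaroui2014, §3 p. 231 (the function `Q_q`)] -/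
theorem hasDerivAt_dQ (q t : ℝ) : HasDerivAt (dQ q) (ddQ q t) t := by
  have h : HasDerivAt (fun y : ℝ ↦ -2 * (1 + q) * y + 4 * q * y ^ 3)
      (-2 * (1 + q) * 1 + 4 * q * (3 * t ^ 2)) t := by
    have h1 : HasDerivAt (fun y : ℝ ↦ -2 * (1 + q) * y) (-2 * (1 + q) * 1) t :=
      (hasDerivAt_id t).const_mul _
    have h2 : HasDerivAt (fun y : ℝ ↦ 4 * q * y ^ 3) (4 * q * (3 * t ^ 2)) t := by
      simpa using (hasDerivAt_pow 3 t).const_mul (4 * q)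
    exact h1.add h2
  refine (h.congr_of_eventuallyEq (Eventually.of_forall fun y ↦ rfl)).congr_deriv ?_
  unfold ddQ; ring

/-- **Identity (b′)**: `(1−t²) L′ = (1−t²) L² + 2t L − Θ ρ` on `(−1,1)`, i.e. the derivative of
`L = Q′/(4Q)` in the form that defines the Liouville correction `Θ`. [cite: Hartman2002, Ch. XI §2] -/
theorem hasDerivAt_Lf (hq1 : q ≤ 1) (ht : t ∈ Ioo (-1 : ℝ) 1) :
    HasDerivAt (Lf q) (((1 - t ^ 2) * Lf q t ^ 2 + 2 * t * Lf q t - theta q t * rho q t) /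
      (1 - t ^ 2)) t := by
  have hQ := Qf_pos hq1 ht
  have hp := one_sub_sq_pos ht
  have hρ := rho_pos hq1 ht
  have h4Q : 4 * Qf q t ≠ 0 := by positivity
  have h : HasDerivAt (Lf q) ((ddQ q t * (4 * Qf q t) - dQ q t * (4 * dQ q t)) / (4 * Qf q t) ^ 2) t :=
    (hasDerivAt_dQ q t).div ((hasDerivAt_Qf q t).const_mul 4) h4Q
  refine h.congr_deriv ?_
  unfold rho at hρ
  have hρ' : (1 - q * t ^ 2) ≠ 0 := hρ.ne'
  unfold Lf theta Bf Qf dQ ddQ rho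
  field_simp
  ring

/-- The closed form `dtheta` IS `Θ′` on `(−1,1)`. [cite: Hartman2002, Ch. XI §2] -/
theorem hasDerivAt_theta (hq1 : q ≤ 1) (ht : t ∈ Ioo (-1 : ℝ) 1) :
    HasDerivAt (theta q) (dtheta q t) t := by
  have hp := one_sub_sq_pos ht
  have hρ := rho_pos hq1 ht
  unfold rho at hρ
  have hB : HasDerivAt (Bf q) (-(4 * (1 + 10 * q - 3 * q ^ 2) * (2 * t)) + 8 * q * (3 - q) * (4 * t ^ 3)) t := by
    have h1 : HasDerivAt (fun y : ℝ ↦ 4 * (1 + 10 * q - 3 * q ^ 2) * y ^ 2)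
        (4 * (1 + 10 * q - 3 * q ^ 2) * (2 * t)) t := by
      simpa using (hasDerivAt_pow 2 t).const_mul (4 * (1 + 10 * q - 3 * q ^ 2))
    have h2 : HasDerivAt (fun y : ℝ ↦ 8 * q * (3 - q) * y ^ 4) (8 * q * (3 - q) * (4 * t ^ 3)) t := by
      simpa using (hasDerivAt_pow 4 t).const_mul (8 * q * (3 - q))
    have h := (h1.const_sub (8 * (1 + q))).add h2
    refine h.congr_of_eventuallyEq (Eventually.of_forall fun y ↦ ?_)
    simp only [Pi.add_apply, Bf]
  have hden : HasDerivAt (fun y : ℝ ↦ 16 * (1 - y ^ 2) * (1 - q * y ^ 2) ^ 3)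
      (16 * (-(2 * t)) * (1 - q * t ^ 2) ^ 3 +
        16 * (1 - t ^ 2) * (3 * (1 - q * t ^ 2) ^ 2 * (-(q * (2 * t))))) t := by
    have h1 : HasDerivAt (fun y : ℝ ↦ 16 * (1 - y ^ 2)) (16 * (-(2 * t))) t := by
      simpa using ((hasDerivAt_pow 2 t).const_sub 1).const_mul 16
    have h2 : HasDerivAt (fun y : ℝ ↦ (1 - q * y ^ 2) ^ 3)
        (3 * (1 - q * t ^ 2) ^ 2 * (-(q * (2 * t)))) t := by
      have h0 : HasDerivAt (fun y : ℝ ↦ 1 - q * y ^ 2) (-(q * (2 * t))) t := by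
        simpa using ((hasDerivAt_pow 2 t).const_mul q).const_sub 1
      have := (hasDerivAt_pow 3 (1 - q * t ^ 2)).comp t h0
      simpa [Function.comp_def] using this
    refine (h1.mul h2).congr_of_eventuallyEq (Eventually.of_forall fun y ↦ ?_)
    simp only [Pi.mul_apply]
  have hne : 16 * (1 - t ^ 2) * (1 - q * t ^ 2) ^ 3 ≠ 0 := by positivity
  have h := hB.div hden hne
  refine (h.congr_of_eventuallyEq (Eventually.of_forall fun y ↦ rfl)).congr_deriv ?_
  unfold dtheta Df Bf
  field_simp
  ring

end derivs


/-! ## §3 Sturm's comparison step on an interior gap (weight `1 − t²`) -/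

section sturm

/-- **Sturm's comparison step on an interior gap**, positive case.  `f`, `g` differentiable on
`(−1, 1)` with fluxes `((1−y²)f₁)′ = q_f f`, `((1−y²)g₁)′ = q_g g`; on a gap `[a, b] ⊂ (−1, 1)` of `f`
(`f(a) = f(b) = 0`) with `q_g ≤ q_f`, `<` somewhere, `f > 0` and `g > 0` inside is impossible
(Wronskian `W = f(1−y²)g₁ − (1−y²)f₁ g` is non-increasing with `W(a) ≤ 0 ≤ W(b)`).  Same argument as the
tree's `sturm_gap_pos_of_potential` (singular end points), here with regular end points.
[cite: Hartman2002, Ch. XI §3 Thm 3.1] -/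
theorem sturm_interior_gap_pos {a b : ℝ} {f g f₁ g₁ qf qg : ℝ → ℝ}
    (ha : -1 < a) (hab : a < b) (hb : b < 1)
    (hfd : ∀ x ∈ Ioo (-1 : ℝ) 1, HasDerivAt f (f₁ x) x)
    (hgd : ∀ x ∈ Ioo (-1 : ℝ) 1, HasDerivAt g (g₁ x) x)
    (hfe : ∀ x ∈ Ioo (-1 : ℝ) 1, HasDerivAt (fun y ↦ (1 - y ^ 2) * f₁ y) (qf x * f x) x)
    (hge : ∀ x ∈ Ioo (-1 : ℝ) 1, HasDerivAt (fun y ↦ (1 - y ^ 2) * g₁ y) (qg x * g x) x)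
    (hf₁c : ContinuousOn f₁ (Icc a b)) (hg₁c : ContinuousOn g₁ (Icc a b))
    (hfa : f a = 0) (hfb : f b = 0)
    (hq : ∀ x ∈ Ioo a b, qg x ≤ qf x) (hq' : ∃ x ∈ Ioo a b, qg x < qf x)
    (hfpos : ∀ x ∈ Ioo a b, 0 < f x) (hgpos : ∀ x ∈ Ioo a b, 0 < g x) : False := by
  set W : ℝ → ℝ := fun x ↦ f x * ((1 - x ^ 2) * g₁ x) - (1 - x ^ 2) * f₁ x * g x with hW
  have hIoo : Ioo a b ⊆ Ioo (-1 : ℝ) 1 := fun x hx ↦ ⟨by linarith [hx.1], by linarith [hx.2]⟩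
  have hIcc : Icc a b ⊆ Ioo (-1 : ℝ) 1 := fun x hx ↦ ⟨by linarith [hx.1], by linarith [hx.2]⟩
  have hfc : ContinuousOn f (Icc a b) :=
    fun x hx ↦ (hfd x (hIcc hx)).continuousAt.continuousWithinAt
  have hgc : ContinuousOn g (Icc a b) :=
    fun x hx ↦ (hgd x (hIcc hx)).continuousAt.continuousWithinAt
  have hWd : ∀ x ∈ Ioo a b, HasDerivAt W ((qg x - qf x) * f x * g x) x := by
    intro x hx
    have hx' := hIoo hx
    have h1 : HasDerivAt (fun y ↦ f y * ((1 - y ^ 2) * g₁ y))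
        (f₁ x * ((1 - x ^ 2) * g₁ x) + f x * (qg x * g x)) x :=
      (hfd x hx').mul (hge x hx')
    have h2 : HasDerivAt (fun y ↦ (1 - y ^ 2) * f₁ y * g y)
        (qf x * f x * g x + (1 - x ^ 2) * f₁ x * g₁ x) x :=
      (hfe x hx').mul (hgd x hx')
    exact (h1.sub h2).congr_deriv (by ring)
  have hp : Continuous fun x : ℝ ↦ 1 - x ^ 2 := by fun_prop
  have hWc : ContinuousOn W (Icc a b) :=
    (hfc.mul (hp.continuousOn.mul hg₁c)).sub ((hp.continuousOn.mul hf₁c).mul hgc)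
  have hanti : AntitoneOn W (Icc a b) := by
    apply antitoneOn_of_deriv_nonpos (convex_Icc a b) hWc
    · rw [interior_Icc]
      exact fun x hx ↦ (hWd x hx).differentiableAt.differentiableWithinAt
    · rw [interior_Icc]
      intro x hx
      rw [(hWd x hx).deriv]
      have : (qg x - qf x) * f x * g x = -((qf x - qg x) * (f x * g x)) := by ring
      rw [this, neg_nonpos]
      exact mul_nonneg (sub_nonneg.mpr (hq x hx)) (mul_pos (hfpos x hx) (hgpos x hx)).le
  have hga : 0 ≤ g a := by
    haveI : (𝓝[Ioo a b] a).NeBot := left_nhdsWithin_Ioo_neBot hab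
    have ht : Tendsto g (𝓝[Ioo a b] a) (𝓝 (g a)) :=
      ((hgc.continuousWithinAt (left_mem_Icc.mpr hab.le)).mono Ioo_subset_Icc_self).tendsto
    exact ge_of_tendsto ht (by
      filter_upwards [self_mem_nhdsWithin] with x hx using (hgpos x hx).le)
  have hgb : 0 ≤ g b := by
    haveI : (𝓝[Ioo a b] b).NeBot := right_nhdsWithin_Ioo_neBot hab
    have ht : Tendsto g (𝓝[Ioo a b] b) (𝓝 (g b)) :=
      ((hgc.continuousWithinAt (right_mem_Icc.mpr hab.le)).mono Ioo_subset_Icc_self).tendsto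
    exact ge_of_tendsto ht (by
      filter_upwards [self_mem_nhdsWithin] with x hx using (hgpos x hx).le)
  have hWa : W a ≤ 0 := by
    have ham : a ∈ Ioo (-1 : ℝ) 1 := ⟨ha, by linarith⟩
    have hf₁a : 0 ≤ f₁ a := hasDerivAt_nonneg_of_pos_right (hfd a ham) hfa hab hfpos
    have hpa : 0 ≤ 1 - a ^ 2 := by nlinarith [ham.1, ham.2]
    have : W a = -((1 - a ^ 2) * f₁ a * g a) := by simp only [hW, hfa, zero_mul, zero_sub]
    rw [this, neg_nonpos]
    exact mul_nonneg (mul_nonneg hpa hf₁a) hga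
  have hWb : 0 ≤ W b := by
    have hbm : b ∈ Ioo (-1 : ℝ) 1 := ⟨by linarith, hb⟩
    have hf₁b : f₁ b ≤ 0 := hasDerivAt_nonpos_of_pos_left (hfd b hbm) hfb hab hfpos
    have hpb : 0 ≤ 1 - b ^ 2 := by nlinarith [hbm.1, hbm.2]
    have : W b = -((1 - b ^ 2) * f₁ b * g b) := by simp only [hW, hfb, zero_mul, zero_sub]
    rw [this, neg_nonneg]
    exact mul_nonpos_of_nonpos_of_nonneg (mul_nonpos_of_nonneg_of_nonpos hpb hf₁b) hgb
  have hW0 : ∀ x ∈ Icc a b, W x = 0 := by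
    intro x hx
    have h1 : W x ≤ W a := hanti (left_mem_Icc.mpr hab.le) hx hx.1
    have h2 : W b ≤ W x := hanti hx (right_mem_Icc.mpr hab.le) hx.2
    linarith
  obtain ⟨x₀, hx₀, hqx₀⟩ := hq'
  have hzero : (qg x₀ - qf x₀) * f x₀ * g x₀ = 0 := by
    have hconst : HasDerivAt W 0 x₀ := by
      have hev : W =ᶠ[𝓝 x₀] fun _ ↦ (0 : ℝ) := by
        filter_upwards [isOpen_Ioo.mem_nhds hx₀] with y hy
        exact hW0 y (Ioo_subset_Icc_self hy)
      exact (hasDerivAt_const x₀ (0 : ℝ)).congr_of_eventuallyEq hev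
    exact (hWd x₀ hx₀).unique hconst
  have hneg : (qg x₀ - qf x₀) * f x₀ * g x₀ < 0 := by
    have : 0 < (qf x₀ - qg x₀) * (f x₀ * g x₀) :=
      mul_pos (sub_pos.mpr hqx₀) (mul_pos (hfpos x₀ hx₀) (hgpos x₀ hx₀))
    linarith [show (qg x₀ - qf x₀) * f x₀ * g x₀ = -((qf x₀ - qg x₀) * (f x₀ * g x₀)) by ring]
  exact hneg.ne hzero

/-- **Sturm's comparison step on an interior gap**: every interior gap `[a,b] ⊂ (−1,1)` of `f`
(`f(a) = f(b) = 0`, `f ≠ 0` inside) contains a zero of `g`, when `q_g ≤ q_f` with `<` somewhere in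
the gap. [cite: Hartman2002, Ch. XI §3 Thm 3.1] -/
theorem sturm_interior_gap {a b : ℝ} {f g f₁ g₁ qf qg : ℝ → ℝ}
    (ha : -1 < a) (hab : a < b) (hb : b < 1)
    (hfd : ∀ x ∈ Ioo (-1 : ℝ) 1, HasDerivAt f (f₁ x) x)
    (hgd : ∀ x ∈ Ioo (-1 : ℝ) 1, HasDerivAt g (g₁ x) x)
    (hfe : ∀ x ∈ Ioo (-1 : ℝ) 1, HasDerivAt (fun y ↦ (1 - y ^ 2) * f₁ y) (qf x * f x) x)
    (hge : ∀ x ∈ Ioo (-1 : ℝ) 1, HasDerivAt (fun y ↦ (1 - y ^ 2) * g₁ y) (qg x * g x) x)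
    (hf₁c : ContinuousOn f₁ (Icc a b)) (hg₁c : ContinuousOn g₁ (Icc a b))
    (hfa : f a = 0) (hfb : f b = 0)
    (hq : ∀ x ∈ Ioo a b, qg x ≤ qf x) (hq' : ∃ x ∈ Ioo a b, qg x < qf x)
    (hfz : ∀ x ∈ Ioo a b, f x ≠ 0) : ∃ z ∈ Ioo a b, g z = 0 := by
  by_contra hcon
  push Not at hcon
  have hIoo : Ioo a b ⊆ Ioo (-1 : ℝ) 1 := fun x hx ↦ ⟨by linarith [hx.1], by linarith [hx.2]⟩
  have hfc : ContinuousOn f (Ioo a b) := fun x hx ↦ (hfd x (hIoo hx)).continuousAt.continuousWithinAt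
  have hgc : ContinuousOn g (Ioo a b) := fun x hx ↦ (hgd x (hIoo hx)).continuousAt.continuousWithinAt
  have hfs := pos_or_neg_of_ne_zero hab hfc hfz
  have hgs := pos_or_neg_of_ne_zero hab hgc hcon
  -- negation preserves the hypotheses
  have negd : ∀ {u u₁ qq : ℝ → ℝ}, (∀ x ∈ Ioo (-1 : ℝ) 1, HasDerivAt u (u₁ x) x) →
      (∀ x ∈ Ioo (-1 : ℝ) 1, HasDerivAt (fun y ↦ (1 - y ^ 2) * u₁ y) (qq x * u x) x) →
      (∀ x ∈ Ioo (-1 : ℝ) 1, HasDerivAt (fun y ↦ -u y) ((fun y ↦ -u₁ y) x) x) ∧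
      (∀ x ∈ Ioo (-1 : ℝ) 1,
        HasDerivAt (fun y ↦ (1 - y ^ 2) * (fun y ↦ -u₁ y) y) (qq x * (fun y ↦ -u y) x) x) := by
    intro u u₁ qq hu hue
    refine ⟨fun x hx ↦ (hu x hx).neg, fun x hx ↦ ?_⟩
    have h := (hue x hx).neg
    refine (h.congr_of_eventuallyEq (Eventually.of_forall fun y ↦ ?_)).congr_deriv ?_
    · simp only [Pi.neg_apply, mul_neg]
    · ring
  rcases hfs with hfp | hfn <;> rcases hgs with hgp | hgn
  · exact sturm_interior_gap_pos ha hab hb hfd hgd hfe hge hf₁c hg₁c hfa hfb hq hq' hfp hgp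
  · obtain ⟨hgd', hge'⟩ := negd hgd hge
    exact sturm_interior_gap_pos ha hab hb hfd hgd' hfe hge' hf₁c hg₁c.neg hfa hfb hq hq' hfp
      (fun x hx ↦ by simpa using hgn x hx)
  · obtain ⟨hfd', hfe'⟩ := negd hfd hfe
    exact sturm_interior_gap_pos ha hab hb hfd' hgd hfe' hge hf₁c.neg hg₁c (by simp [hfa]) (by simp [hfb])
      hq hq' (fun x hx ↦ by simpa using hfn x hx) hgp
  · obtain ⟨hfd', hfe'⟩ := negd hfd hfe
    obtain ⟨hgd', hge'⟩ := negd hgd hge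
    exact sturm_interior_gap_pos ha hab hb hfd' hgd' hfe' hge' hf₁c.neg hg₁c.neg (by simp [hfa])
      (by simp [hfb]) hq hq' (fun x hx ↦ by simpa using hfn x hx) (fun x hx ↦ by simpa using hgn x hx)

end sturm


/-! ## §4 The abstract unit-interval prolate datum -/

/-- RH-FREE interface (hypotheses only, asserts nothing by itself).  **A unit-interval prolate
solution with `n` zeros**: `g ∈ C¹([−1,1])` (`g`, `g₁` continuous on `[−1,1]`, `g′ = g₁` inside) solving
`((1 − t²) g′)′ = −χ(1 − q t²) g` on `(−1, 1)` — Bonami–Karoui's `L_c ψ = χ ψ`, eq. (1), with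
`q = c²/χ` (eq. (3)) — where `χ > 0`, `0 ≤ q < 1` («`q < 1`», i.e. `χ_n(c) > c²`), with exactly `n` zeros
in `(−1, 1)`.  The PSWF `ψ_{n,c}` (analytic on `[−1,1]`) is such a datum; so is `t ↦ λ^{1/2} h_{n,λ}(λt)`
for the tree's `IsProlateFunction lam n` (`IsProlateFunction.isUnitPSWF_rescale`).
[cite: BonamiKaroui2014, §1 eqs. (1), (3) p. 229–230; Osipov2013, §2.1 eqs. (1)–(2), Thms 1, 3] -/
structure IsUnitPSWF (χ q : ℝ) (n : ℕ) (g g₁ : ℝ → ℝ) : Prop where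
  chi_pos : 0 < χ
  q_nonneg : 0 ≤ q
  q_lt_one : q < 1
  cont : ContinuousOn g (Icc (-1) 1)
  cont₁ : ContinuousOn g₁ (Icc (-1) 1)
  hasDeriv : ∀ t ∈ Ioo (-1 : ℝ) 1, HasDerivAt g (g₁ t) t
  flux : ∀ t ∈ Ioo (-1 : ℝ) 1, HasDerivAt (fun y ↦ (1 - y ^ 2) * g₁ y) (-(χ * rho q t) * g t) t
  zeros_finite : {t : ℝ | t ∈ Ioo (-1 : ℝ) 1 ∧ g t = 0}.Finite
  zeros_card : {t : ℝ | t ∈ Ioo (-1 : ℝ) 1 ∧ g t = 0}.ncard = n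

/-! ## §5 The Liouville comparison function `G = sin(k S + φ)/Q^{1/4}` -/

section comparison

variable {q : ℝ}

/-- RH-FREE object. `w = Q^{1/4} = √(√Q)`. [cite: Hartman2002, Ch. XI §2] -/
def wf (q t : ℝ) : ℝ := Real.sqrt (Real.sqrt (Qf q t))

/-- RH-FREE object. `σ = S′ = w²/(1−t²) = √((1−qt²)/(1−t²))`. [cite: BonamiKaroui2014, eq. (10) p. 231] -/
def sigma (q t : ℝ) : ℝ := wf q t ^ 2 / (1 - t ^ 2)

/-- RH-FREE object. The Liouville variable `S(t) = ∫₀ᵗ √((1−qx²)/(1−x²)) dx` (increasing version of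
Bonami–Karoui's (10)). [cite: BonamiKaroui2014, eq. (10) p. 231] -/
def Sf (q t : ℝ) : ℝ := ∫ x in (0 : ℝ)..t, sigma q x

/-- RH-FREE object. The comparison function `G(t) = sin(k S(t) + φ)/Q(t)^{1/4}`: a solution of
`((1−t²)G′)′ = (Θ − k²)(1−qt²) G`. [cite: Hartman2002, Ch. XI §2–§3] -/
def Gf (q k φ t : ℝ) : ℝ := Real.sin (k * Sf q t + φ) / wf q t

/-- RH-FREE object. `G′` in closed form: `k cos(kS+φ) w/(1−t²) − sin(kS+φ) L/w`.
[cite: Hartman2002, Ch. XI §2–§3] -/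
def Gd (q k φ t : ℝ) : ℝ :=
  k * Real.cos (k * Sf q t + φ) * wf q t / (1 - t ^ 2) - Real.sin (k * Sf q t + φ) * Lf q t / wf q t

variable {t : ℝ}

/-- `w > 0` on `(−1,1)`. [cite: Hartman2002, Ch. XI §2 (Liouville normal form); BonamiKaroui2014, proof of Prop. 2.1 p. 231] -/
theorem wf_pos (hq1 : q ≤ 1) (ht : t ∈ Ioo (-1 : ℝ) 1) : 0 < wf q t :=
  Real.sqrt_pos.2 (Real.sqrt_pos.2 (Qf_pos hq1 ht))

/-- `w² = √Q`. [cite: Hartman2002, Ch. XI §2 (Liouville normal form); BonamiKaroui2014, proof of Prop. 2.1 p. 231] -/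
theorem wf_sq (q t : ℝ) : wf q t ^ 2 = Real.sqrt (Qf q t) :=
  Real.sq_sqrt (Real.sqrt_nonneg _)

/-- `w⁴ = Q = (1−t²)ρ` on `(−1,1)`. [cite: Hartman2002, Ch. XI §2 (Liouville normal form); BonamiKaroui2014, proof of Prop. 2.1 p. 231] -/
theorem wf_pow_four (hq1 : q ≤ 1) (ht : t ∈ Ioo (-1 : ℝ) 1) : wf q t ^ 4 = (1 - t ^ 2) * rho q t := by
  rw [show wf q t ^ 4 = (wf q t ^ 2) ^ 2 by ring, wf_sq, Real.sq_sqrt (Qf_pos hq1 ht).le, Qf_eq]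

/-- `ρ = w⁴/(1−t²)` on `(−1,1)`. [cite: Hartman2002, Ch. XI §2 (Liouville normal form); BonamiKaroui2014, proof of Prop. 2.1 p. 231] -/
theorem rho_eq_wf_pow_four_div (hq1 : q ≤ 1) (ht : t ∈ Ioo (-1 : ℝ) 1) :
    rho q t = wf q t ^ 4 / (1 - t ^ 2) := by
  rw [wf_pow_four hq1 ht, mul_div_cancel_left₀ _ (one_sub_sq_pos ht).ne']

/-- `w′ = L w` on `(−1,1)`. [cite: Hartman2002, Ch. XI §2] -/
theorem hasDerivAt_wf (hq1 : q ≤ 1) (ht : t ∈ Ioo (-1 : ℝ) 1) :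
    HasDerivAt (wf q) (Lf q t * wf q t) t := by
  have hQ := Qf_pos hq1 ht
  have hsQ : 0 < Real.sqrt (Qf q t) := Real.sqrt_pos.2 hQ
  have hw := wf_pos hq1 ht
  have h1 : HasDerivAt (fun y ↦ Real.sqrt (Qf q y)) (dQ q t / (2 * Real.sqrt (Qf q t))) t :=
    (hasDerivAt_Qf q t).sqrt hQ.ne'
  have h2 : HasDerivAt (fun y ↦ Real.sqrt (Real.sqrt (Qf q y)))
      (dQ q t / (2 * Real.sqrt (Qf q t)) / (2 * Real.sqrt (Real.sqrt (Qf q t)))) t :=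
    h1.sqrt hsQ.ne'
  refine (h2.congr_of_eventuallyEq (Eventually.of_forall fun y ↦ rfl)).congr_deriv ?_
  have hww : Real.sqrt (Real.sqrt (Qf q t)) = wf q t := rfl
  rw [hww]
  have hsq : Real.sqrt (Qf q t) = wf q t ^ 2 := (wf_sq q t).symm
  have hQ4 : Qf q t = wf q t ^ 4 := by
    rw [show wf q t ^ 4 = (wf q t ^ 2) ^ 2 by ring, wf_sq, Real.sq_sqrt hQ.le]
  unfold Lf
  rw [hsq, hQ4]
  field_simp
  ring

/-- `Q_q` is continuous. [cite: BonamiKaroui2014, §3 p. 231 (the function `Q_q`)] -/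
theorem continuous_Qf (q : ℝ) : Continuous (Qf q) := by
  have : Continuous fun t : ℝ ↦ (1 - t ^ 2) * (1 - q * t ^ 2) := by fun_prop
  exact this.congr fun t ↦ rfl

/-- `w` is continuous. [cite: Hartman2002, Ch. XI §2 (Liouville normal form); BonamiKaroui2014, proof of Prop. 2.1 p. 231] -/
theorem continuous_wf (q : ℝ) : Continuous (wf q) :=
  (Real.continuous_sqrt.comp (Real.continuous_sqrt.comp (continuous_Qf q))).congr fun _ ↦ rfl

/-- `w` is continuous on `(−1,1)`. [cite: Hartman2002, Ch. XI §2 (Liouville normal form); BonamiKaroui2014, proof of Prop. 2.1 p. 231] -/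
theorem continuousOn_wf (q : ℝ) : ContinuousOn (wf q) (Ioo (-1 : ℝ) 1) := (continuous_wf q).continuousOn

/-- `σ` is continuous on `(−1,1)`. [cite: BonamiKaroui2014, eq. (10) p. 231; Hartman2002, Ch. XI §2] -/
theorem continuousOn_sigma (q : ℝ) : ContinuousOn (sigma q) (Ioo (-1 : ℝ) 1) := by
  refine ((continuousOn_wf q).pow 2).div (by fun_prop) fun x hx ↦ (one_sub_sq_pos hx).ne'

/-- `L` is continuous on `(−1,1)` (for `q ≤ 1`). [cite: Hartman2002, Ch. XI §2 (Liouville normal form); BonamiKaroui2014, proof of Prop. 2.1 p. 231] -/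
theorem continuousOn_Lf (hq1 : q ≤ 1) : ContinuousOn (Lf q) (Ioo (-1 : ℝ) 1) := by
  unfold Lf
  refine ContinuousOn.div (by unfold dQ; fun_prop) (by unfold Qf; fun_prop) fun x hx ↦ ?_
  exact (mul_pos (by norm_num : (0:ℝ) < 4) (Qf_pos hq1 hx)).ne'

/-- `σ ≥ 1` on `(−1,1)` (`1 − qt² ≥ 1 − t²`). [cite: Osipov2012Inequalities, proof of Thm. 13 («(2 t_n/π)√χ_n»)] -/
theorem one_le_sigma (hq1 : q ≤ 1) (ht : t ∈ Ioo (-1 : ℝ) 1) : 1 ≤ sigma q t := by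
  have hp := one_sub_sq_pos ht
  have hw4 := wf_pow_four hq1 ht
  unfold sigma
  rw [le_div_iff₀ hp, one_mul]
  -- `(1−t²)² ≤ w⁴ = (1−t²)(1−qt²)`
  have hρp : 1 - t ^ 2 ≤ rho q t := by unfold rho; nlinarith [sq_nonneg t]
  have h4 : (1 - t ^ 2) ^ 2 ≤ (wf q t ^ 2) ^ 2 := by
    rw [show (wf q t ^ 2) ^ 2 = wf q t ^ 4 by ring, hw4]; nlinarith
  by_contra hcon
  push Not at hcon
  nlinarith [mul_pos (sub_pos.2 hcon) (add_pos_of_pos_of_nonneg hp (sq_nonneg (wf q t)))]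

/-- `σ ≥ 2` where `(4 − q)t² ≥ 3`. [cite: BonamiKaroui2014, eq. (10) p. 231; Hartman2002, Ch. XI §2] -/
theorem two_le_sigma (hq1 : q ≤ 1) (ht : t ∈ Ioo (-1 : ℝ) 1) (h3 : 3 ≤ (4 - q) * t ^ 2) :
    2 ≤ sigma q t := by
  have hp := one_sub_sq_pos ht
  have hw4 := wf_pow_four hq1 ht
  unfold sigma
  rw [le_div_iff₀ hp]
  have hρp : 4 * (1 - t ^ 2) ≤ rho q t := by unfold rho; nlinarith
  have h4 : (2 * (1 - t ^ 2)) ^ 2 ≤ (wf q t ^ 2) ^ 2 := by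
    rw [show (wf q t ^ 2) ^ 2 = wf q t ^ 4 by ring, hw4]; nlinarith
  by_contra hcon
  push Not at hcon
  nlinarith [mul_pos (sub_pos.2 hcon) (add_pos_of_pos_of_nonneg (by positivity : (0:ℝ) < 2 * (1 - t ^ 2))
    (sq_nonneg (wf q t)))]

/-- `S′ = σ` on `(−1,1)`. [cite: BonamiKaroui2014, eq. (10) p. 231; Hartman2002, Ch. XI §2] -/
theorem hasDerivAt_Sf (q : ℝ) (ht : t ∈ Ioo (-1 : ℝ) 1) : HasDerivAt (Sf q) (sigma q t) t := by
  have h0 : (0 : ℝ) ∈ Ioo (-1 : ℝ) 1 := ⟨by norm_num, by norm_num⟩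
  have hsub : uIcc 0 t ⊆ Ioo (-1 : ℝ) 1 := ordConnected_Ioo.uIcc_subset h0 ht
  have hint : IntervalIntegrable (sigma q) volume 0 t :=
    ((continuousOn_sigma q).mono hsub).intervalIntegrable
  have hcont : ContinuousAt (sigma q) t := (continuousOn_sigma q).continuousAt (isOpen_Ioo.mem_nhds ht)
  exact intervalIntegral.integral_hasDerivAt_right hint
    ((continuousOn_sigma q).stronglyMeasurableAtFilter isOpen_Ioo t ht) hcont

/-- `S` is continuous and strictly increasing on `(−1,1)`. [cite: BonamiKaroui2014, eq. (10) p. 231; Hartman2002, Ch. XI §2] -/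
theorem strictMonoOn_Sf (hq1 : q ≤ 1) : StrictMonoOn (Sf q) (Ioo (-1 : ℝ) 1) := by
  refine strictMonoOn_of_deriv_pos (convex_Ioo _ _)
    (fun _ hx ↦ (hasDerivAt_Sf q hx).continuousAt.continuousWithinAt) fun x hx ↦ ?_
  rw [interior_Ioo] at hx
  rw [(hasDerivAt_Sf q hx).deriv]
  exact lt_of_lt_of_le one_pos (one_le_sigma hq1 hx)

/-- `S` is continuous on `(−1,1)`. [cite: BonamiKaroui2014, eq. (10) p. 231; Hartman2002, Ch. XI §2] -/
theorem continuousOn_Sf (q : ℝ) : ContinuousOn (Sf q) (Ioo (-1 : ℝ) 1) :=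
  fun _ hx ↦ (hasDerivAt_Sf q hx).continuousAt.continuousWithinAt

/-- The Liouville variable increases by MORE than `2` across `(−1,1)` (indeed by `2E(√q) > 2`):
there is `t* ∈ (0,1)` with `S(t*) − S(−t*) > 2`. [cite: Osipov2012Inequalities, Thm. 13 (the elliptic integral `E`)] -/
theorem exists_Sf_sub_Sf_gt_two (hq1 : q < 1) :
    ∃ ts ∈ Ioo (0 : ℝ) 1, 2 < Sf q ts - Sf q (-ts) := by
  -- the threshold `x_q = √(3/(4−q)) < 1` beyond which `σ ≥ 2`
  set xq : ℝ := Real.sqrt (3 / (4 - q)) with hxq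
  have h4q : 0 < 4 - q := by linarith
  have hxq0 : 0 ≤ xq := Real.sqrt_nonneg _
  have hxq1 : xq < 1 := by
    rw [hxq, Real.sqrt_lt' one_pos, div_lt_iff₀ h4q]; linarith
  have hxq2 : xq ^ 2 = 3 / (4 - q) := by rw [hxq, Real.sq_sqrt (div_pos (by norm_num) h4q).le]
  set ts : ℝ := (5 + xq) / 6 with hts
  have hts0 : 0 < ts := by rw [hts]; linarith
  have hts1 : ts < 1 := by rw [hts]; linarith
  have htsx : xq < ts := by rw [hts]; linarith
  refine ⟨ts, ⟨hts0, hts1⟩, ?_⟩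
  have hmem : ∀ x ∈ Icc (-ts) ts, x ∈ Ioo (-1 : ℝ) 1 := fun x hx ↦ ⟨by linarith [hx.1], by linarith [hx.2]⟩
  have hcont : ContinuousOn (sigma q) (Icc (-ts) ts) := (continuousOn_sigma q).mono fun x hx ↦ hmem x hx
  have hii : ∀ a b, -ts ≤ a → a ≤ b → b ≤ ts → IntervalIntegrable (sigma q) volume a b := by
    intro a b ha hab hb
    exact (hcont.mono fun x hx ↦ ⟨by rcases mem_uIcc.1 hx with h | h <;> linarith [h.1],
      by rcases mem_uIcc.1 hx with h | h <;> linarith [h.2]⟩).intervalIntegrable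
  -- `S(ts) − S(−ts) = ∫_{−ts}^{ts} σ = ∫_{−ts}^{xq} σ + ∫_{xq}^{ts} σ ≥ (xq + ts) + 2(ts − xq)`
  have hsub : Sf q ts - Sf q (-ts) = ∫ x in (-ts)..ts, sigma q x := by
    unfold Sf
    exact intervalIntegral.integral_interval_sub_left (hii 0 ts (by linarith) hts0.le le_rfl)
      ((hcont.mono fun x hx ↦ ⟨by rcases mem_uIcc.1 hx with h | h <;> linarith [h.1],
        by rcases mem_uIcc.1 hx with h | h <;> linarith [h.2]⟩).intervalIntegrable)
  have h1 : IntervalIntegrable (sigma q) volume (-ts) xq := hii _ _ le_rfl (by linarith) htsx.le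
  have h2 : IntervalIntegrable (sigma q) volume xq ts := hii _ _ (by linarith) htsx.le le_rfl
  have hsplit : ∫ x in (-ts)..ts, sigma q x = (∫ x in (-ts)..xq, sigma q x) + ∫ x in xq..ts, sigma q x :=
    (intervalIntegral.integral_add_adjacent_intervals h1 h2).symm
  have hI1 : xq + ts ≤ ∫ x in (-ts)..xq, sigma q x := by
    have := intervalIntegral.integral_mono_on (by linarith : -ts ≤ xq) intervalIntegrable_const h1
      (fun x hx ↦ one_le_sigma hq1.le (hmem x ⟨hx.1, by linarith [hx.2]⟩))
    simpa using this
  have hI2 : 2 * (ts - xq) ≤ ∫ x in xq..ts, sigma q x := by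
    have := intervalIntegral.integral_mono_on htsx.le intervalIntegrable_const h2
      (fun x hx ↦ two_le_sigma hq1.le (hmem x ⟨by linarith [hx.1], hx.2⟩) (by
        have hx2 : xq ^ 2 ≤ x ^ 2 := pow_le_pow_left₀ hxq0 hx.1 2
        rw [hxq2] at hx2
        have := (div_le_iff₀ h4q).1 hx2
        linarith))
    simpa [mul_comm] using this
  rw [hsub, hsplit]
  have : 2 < xq + ts + 2 * (ts - xq) := by rw [hts]; linarith
  linarith

/-- `G′ = Gd` on `(−1,1)`. [cite: Hartman2002, Ch. XI §2–§3] -/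
theorem hasDerivAt_Gf (hq1 : q ≤ 1) (k φ : ℝ) (ht : t ∈ Ioo (-1 : ℝ) 1) :
    HasDerivAt (Gf q k φ) (Gd q k φ t) t := by
  have hp := one_sub_sq_pos ht
  have hw := wf_pos hq1 ht
  have hu : HasDerivAt (fun y ↦ k * Sf q y + φ) (k * sigma q t) t :=
    ((hasDerivAt_Sf q ht).const_mul k).add_const φ
  have hsin : HasDerivAt (fun y ↦ Real.sin (k * Sf q y + φ))
      (Real.cos (k * Sf q t + φ) * (k * sigma q t)) t := (Real.hasDerivAt_sin _).comp t hu
  have h := hsin.div (hasDerivAt_wf hq1 ht) hw.ne'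
  refine (h.congr_of_eventuallyEq (Eventually.of_forall fun y ↦ rfl)).congr_deriv ?_
  unfold Gd sigma
  field_simp

/-- **The comparison equation**: `((1−t²) G′)′ = (Θ − k²)(1 − qt²) G` on `(−1,1)` — the Liouville
normal form `U″ + (k² + Θ − k²… )` read backwards for `U = sin(k s + φ)`.
[cite: Hartman2002, Ch. XI §2–§3] -/
theorem hasDerivAt_flux_Gd (hq1 : q ≤ 1) (k φ : ℝ) (ht : t ∈ Ioo (-1 : ℝ) 1) :
    HasDerivAt (fun y ↦ (1 - y ^ 2) * Gd q k φ y)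
      ((theta q t - k ^ 2) * rho q t * Gf q k φ t) t := by
  have hp := one_sub_sq_pos ht
  have hw := wf_pos hq1 ht
  have hu : HasDerivAt (fun y ↦ k * Sf q y + φ) (k * sigma q t) t :=
    ((hasDerivAt_Sf q ht).const_mul k).add_const φ
  have hsin : HasDerivAt (fun y ↦ Real.sin (k * Sf q y + φ))
      (Real.cos (k * Sf q t + φ) * (k * sigma q t)) t := (Real.hasDerivAt_sin _).comp t hu
  have hcos : HasDerivAt (fun y ↦ Real.cos (k * Sf q y + φ))
      (-Real.sin (k * Sf q t + φ) * (k * sigma q t)) t := (Real.hasDerivAt_cos _).comp t hu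
  have hwd := hasDerivAt_wf hq1 ht
  have hL := hasDerivAt_Lf hq1 ht
  have hpd : HasDerivAt (fun y : ℝ ↦ 1 - y ^ 2) (-(2 * t)) t := by
    simpa using (hasDerivAt_pow 2 t).const_sub 1
  have h1 : HasDerivAt (fun y ↦ k * Real.cos (k * Sf q y + φ) * wf q y / (1 - y ^ 2)) _ t :=
    (((hcos.const_mul k).mul hwd).div hpd hp.ne')
  have h2 : HasDerivAt (fun y ↦ Real.sin (k * Sf q y + φ) * Lf q y / wf q y) _ t :=
    ((hsin.mul hL).div hwd hw.ne')
  have hGd : HasDerivAt (Gd q k φ) _ t :=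
    (h1.sub h2).congr_of_eventuallyEq (Eventually.of_forall fun y ↦ rfl)
  have h := hpd.mul hGd
  refine (h.congr_of_eventuallyEq (Eventually.of_forall fun y ↦ rfl)).congr_deriv ?_
  rw [rho_eq_wf_pow_four_div hq1 ht]
  unfold Gd Gf sigma
  simp only [Pi.mul_apply]
  field_simp
  ring

/-- `G`'s derivative `Gd` is continuous on `(−1,1)`. [cite: Hartman2002, Ch. XI §2 (Liouville normal form); BonamiKaroui2014, proof of Prop. 2.1 p. 231] -/
theorem continuousOn_Gd (hq1 : q ≤ 1) (k φ : ℝ) : ContinuousOn (Gd q k φ) (Ioo (-1 : ℝ) 1) := by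
  have hS := continuousOn_Sf q
  have hu : ContinuousOn (fun y ↦ k * Sf q y + φ) (Ioo (-1 : ℝ) 1) :=
    (hS.const_smul k |>.congr fun y _ ↦ by simp [smul_eq_mul]).add continuousOn_const
  unfold Gd
  refine ContinuousOn.sub ?_ ?_
  · refine ContinuousOn.div ?_ (by fun_prop) fun x hx ↦ (one_sub_sq_pos hx).ne'
    exact ((continuousOn_const.mul (Real.continuous_cos.comp_continuousOn hu)).mul (continuousOn_wf q))
  · refine ContinuousOn.div ?_ (continuousOn_wf q) fun x hx ↦ (wf_pos hq1 hx).ne'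
    exact (Real.continuous_sin.comp_continuousOn hu).mul (continuousOn_Lf hq1)

end comparison

/-! ## §6 Osipov's bound for the abstract datum -/

section osipov

variable {χ q : ℝ} {n : ℕ} {g g₁ : ℝ → ℝ}

/-- **Osipov's theorem, abstract unit-interval form**: a `C¹([−1,1])` solution of
`((1−t²)g′)′ = −χ(1−qt²)g` with `0 ≤ q < 1`, `χ > 0` and exactly `n` zeros in `(−1,1)` has
`χ < (π(n+1)/2)²`.  (Printed: `n ≥ 2` and `ψ = ψ_n`; the Sturm–Liouville argument below needs neither.)
[cite: Osipov2013, Thm. 8; Osipov2012Inequalities, Thm. 13; Hartman2002, Ch. XI §3 Thm 3.1] -/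
theorem chi_lt_of_isUnitPSWF (h : IsUnitPSWF χ q n g g₁) :
    χ < (π * (n + 1) / 2) ^ 2 := by
  by_contra hle
  push Not at hle
  have hq := h.q_nonneg
  have hq1 := h.q_lt_one
  have hχ := h.chi_pos
  set k : ℝ := Real.sqrt χ with hk
  have hk0 : 0 < k := Real.sqrt_pos.2 hχ
  have hk2 : k ^ 2 = χ := Real.sq_sqrt hχ.le
  have hkge : π * (n + 1) / 2 ≤ k := by
    rw [hk, ← Real.sqrt_sq (by positivity : (0:ℝ) ≤ π * (n + 1) / 2)]
    exact Real.sqrt_le_sqrt hle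
  -- the span of the Liouville variable
  obtain ⟨ts, hts, hspan⟩ := exists_Sf_sub_Sf_gt_two hq1
  have htsI : ∀ x ∈ Icc (-ts) ts, x ∈ Ioo (-1 : ℝ) 1 :=
    fun x hx ↦ ⟨by linarith [hx.1, hts.2], by linarith [hx.2, hts.2]⟩
  set φ : ℝ := -(k * Sf q (-ts)) with hφ
  -- the targets `s_j = S(−ts) + jπ/k`, `j = 0, …, n+1`, all in `[S(−ts), S(ts)]`
  have hstep : (n + 1 : ℝ) * (π / k) ≤ 2 := by
    rw [← mul_div_assoc, div_le_iff₀ hk0]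
    nlinarith
  have hSmono := strictMonoOn_Sf hq1.le
  have hScont : ContinuousOn (Sf q) (Icc (-ts) ts) := (continuousOn_Sf q).mono fun x hx ↦ htsI x hx
  have htarget : ∀ j : ℕ, j ≤ n + 1 →
      Sf q (-ts) + j * (π / k) ∈ Icc (Sf q (-ts)) (Sf q ts) := by
    intro j hj
    refine ⟨by have : (0:ℝ) ≤ j * (π / k) := by positivity
               linarith, ?_⟩
    have hj' : (j : ℝ) * (π / k) ≤ (n + 1 : ℝ) * (π / k) :=
      mul_le_mul_of_nonneg_right (by exact_mod_cast hj) (by positivity)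
    linarith
  -- points `t_j` with `S(t_j) = s_j`
  have hpts : ∀ j : ℕ, j ≤ n + 1 → ∃ tj ∈ Icc (-ts) ts, Sf q tj = Sf q (-ts) + j * (π / k) := by
    intro j hj
    exact intermediate_value_Icc (by linarith [hts.1]) hScont (htarget j hj)
  choose! tp htp hStp using hpts
  -- `t_j` is strictly increasing in `j`
  have htp_lt : ∀ j : ℕ, j + 1 ≤ n + 1 → tp j < tp (j + 1) := by
    intro j hj
    have h1 := hStp j (by omega)
    have h2 := hStp (j + 1) hj
    have hlt : Sf q (tp j) < Sf q (tp (j + 1)) := by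
      rw [h1, h2]; push_cast; nlinarith [div_pos Real.pi_pos hk0]
    exact (hSmono.lt_iff_lt (htsI _ (htp j (by omega))) (htsI _ (htp (j+1) hj))).1 hlt
  -- `G = sin(k S + φ)/w` vanishes at the `t_j` and nowhere in between
  have hGzero : ∀ j : ℕ, j ≤ n + 1 → Gf q k φ (tp j) = 0 := by
    intro j hj
    unfold Gf
    rw [hStp j hj, hφ]
    have : k * (Sf q (-ts) + j * (π / k)) + -(k * Sf q (-ts)) = j * π := by
      field_simp
      ring
    rw [this, Real.sin_nat_mul_pi, zero_div]
  have hGne : ∀ j : ℕ, j + 1 ≤ n + 1 → ∀ x ∈ Ioo (tp j) (tp (j + 1)), Gf q k φ x ≠ 0 := by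
    intro j hj x hx
    have hxI : x ∈ Ioo (-1 : ℝ) 1 :=
      ⟨by linarith [hx.1, (htp j (by omega)).1, hts.2], by linarith [hx.2, (htp (j+1) hj).2, hts.2]⟩
    have hS1 : Sf q (tp j) < Sf q x := hSmono (htsI _ (htp j (by omega))) hxI hx.1
    have hS2 : Sf q x < Sf q (tp (j + 1)) := hSmono hxI (htsI _ (htp (j+1) hj)) hx.2
    rw [hStp j (by omega)] at hS1
    rw [hStp (j + 1) hj] at hS2
    unfold Gf
    refine div_ne_zero ?_ (wf_pos hq1.le hxI).ne'
    -- the phase lies strictly between `jπ` and `(j+1)π`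
    have hlo : (j : ℝ) * π < k * Sf q x + φ := by
      rw [hφ]
      have := mul_lt_mul_of_pos_left hS1 hk0
      have e : k * (Sf q (-ts) + j * (π / k)) = k * Sf q (-ts) + j * π := by field_simp
      linarith
    have hhi : k * Sf q x + φ < ((j : ℝ) + 1) * π := by
      rw [hφ]
      have := mul_lt_mul_of_pos_left hS2 hk0
      have e : k * (Sf q (-ts) + ((j + 1 : ℕ) : ℝ) * (π / k)) = k * Sf q (-ts) + (j + 1) * π := by
        push_cast; field_simp
      linarith
    intro hsin
    obtain ⟨m, hm⟩ := Real.sin_eq_zero_iff.1 hsin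
    -- `jπ < mπ < (j+1)π` is impossible
    have h1 : (j : ℝ) < m := by
      have : (j : ℝ) * π < m * π := by linarith
      exact lt_of_mul_lt_mul_right this Real.pi_pos.le
    have h2 : (m : ℝ) < j + 1 := by
      have : (m : ℝ) * π < (j + 1) * π := by linarith
      exact lt_of_mul_lt_mul_right this Real.pi_pos.le
    have h1' : (j : ℤ) < m := by exact_mod_cast h1
    have h2' : m < (j : ℤ) + 1 := by exact_mod_cast h2
    omega
  -- Sturm: each gap `(t_j, t_{j+1})`, `j = 0..n`, contains a zero of `g`
  have hzero : ∀ j : ℕ, j + 1 ≤ n + 1 → ∃ z ∈ Ioo (tp j) (tp (j + 1)), g z = 0 := by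
    intro j hj
    have hja := htp j (by omega)
    have hjb := htp (j + 1) hj
    have ha : -1 < tp j := (htsI _ hja).1
    have hb : tp (j + 1) < 1 := (htsI _ hjb).2
    have hsubI : Icc (tp j) (tp (j + 1)) ⊆ Ioo (-1 : ℝ) 1 :=
      fun x hx ↦ ⟨by linarith [hx.1], by linarith [hx.2]⟩
    refine sturm_interior_gap (f := Gf q k φ) (g := g) (f₁ := Gd q k φ) (g₁ := g₁)
      (qf := fun x ↦ (theta q x - k ^ 2) * rho q x) (qg := fun x ↦ -(χ * rho q x))
      ha (htp_lt j hj) hb (fun x hx ↦ hasDerivAt_Gf hq1.le k φ hx) h.hasDeriv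
      (fun x hx ↦ hasDerivAt_flux_Gd hq1.le k φ hx) h.flux
      ((continuousOn_Gd hq1.le k φ).mono hsubI) (h.cont₁.mono (hsubI.trans Ioo_subset_Icc_self))
      (hGzero j (by omega)) (hGzero (j + 1) hj) ?_ ?_ (hGne j hj)
    · intro x hx
      have hxI : x ∈ Ioo (-1 : ℝ) 1 := hsubI (Ioo_subset_Icc_self hx)
      show -(χ * rho q x) ≤ (theta q x - k ^ 2) * rho q x
      rw [hk2]
      nlinarith [theta_pos hq hq1 hxI, rho_pos hq1.le hxI]
    · refine ⟨(tp j + tp (j + 1)) / 2, ⟨by linarith [htp_lt j hj], by linarith [htp_lt j hj]⟩, ?_⟩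
      have hxI : (tp j + tp (j + 1)) / 2 ∈ Ioo (-1 : ℝ) 1 :=
        hsubI ⟨by linarith [htp_lt j hj], by linarith [htp_lt j hj]⟩
      show -(χ * rho q _) < (theta q _ - k ^ 2) * rho q _
      rw [hk2]
      nlinarith [theta_pos hq hq1 hxI, rho_pos hq1.le hxI]
  choose! z hz hgz using hzero
  -- the `n + 1` zeros `z_0 < z_1 < ⋯ < z_n` of `g`
  have hzmono : StrictMono (fun j : Fin (n + 1) ↦ z j) := by
    refine Fin.strictMono_iff_lt_succ.2 fun j ↦ ?_
    have hjlt := j.isLt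
    show z (j : ℕ) < z ((j : ℕ) + 1)
    exact lt_trans (hz j (by omega)).2 (hz (j + 1) (by omega)).1
  have hzmem : ∀ j : Fin (n + 1), z j ∈ {t : ℝ | t ∈ Ioo (-1 : ℝ) 1 ∧ g t = 0} := by
    intro j
    have hj1 : (j : ℕ) + 1 ≤ n + 1 := by omega
    have hzj := hz j hj1
    exact ⟨⟨by linarith [hzj.1, (htsI _ (htp j (by omega))).1],
      by linarith [hzj.2, (htsI _ (htp (j+1) hj1)).2]⟩, hgz j hj1⟩
  have hcard : n + 1 ≤ {t : ℝ | t ∈ Ioo (-1 : ℝ) 1 ∧ g t = 0}.ncard := by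
    have hsub : Set.range (fun j : Fin (n + 1) ↦ z j) ⊆ {t : ℝ | t ∈ Ioo (-1 : ℝ) 1 ∧ g t = 0} := by
      rintro _ ⟨j, rfl⟩; exact hzmem j
    have h1 := Set.ncard_le_ncard hsub h.zeros_finite
    rw [Set.ncard_range_of_injective hzmono.injective, Nat.card_eq_fintype_card, Fintype.card_fin] at h1
    exact h1
  rw [h.zeros_card] at hcard
  omega

end osipov

/-! ## §7 Rescaling the tree's prolate functions to the unit interval -/

section rescale

/-- RH-FREE object. The unit-interval rescaling `g(t) = λ^{1/2} f(λt)` of a function on `[−λ, λ]`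
(`‖g‖_{L²[−1,1]} = ‖f‖_{L²[−λ,λ]}`, `g(1) = λ^{1/2} f(λ)`).
[cite: BonamiKaroui2014, §1 (normalisation «L²([−1,1]) norm equal to 1»)] -/
def rescale (lam : ℝ) (f : ℝ → ℝ) (t : ℝ) : ℝ := Real.sqrt lam * f (lam * t)

/-- RH-FREE object. The derivative datum of the rescaling: `g₁(t) = λ^{1/2}·λ·f′(λt)` with the
one-sided derivative `derivWithin f [−λ,λ]`. [cite: BonamiKaroui2014, §1 eq. (1) (the substitution `x = λt`)] -/
def rescaleDeriv (lam : ℝ) (f : ℝ → ℝ) (t : ℝ) : ℝ :=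
  Real.sqrt lam * (derivWithin f (Icc (-lam) lam) (lam * t) * lam)

variable {lam : ℝ} {n : ℕ} {f : ℝ → ℝ}

/-- `t ∈ (−1,1) ⇒ λt ∈ (−λ,λ)`. [folklore] -/
private theorem mul_mem_Ioo_of_mem_Ioo (hlam : 0 < lam) {t : ℝ} (ht : t ∈ Ioo (-1 : ℝ) 1) :
    lam * t ∈ Ioo (-lam) lam := ⟨by nlinarith [ht.1], by nlinarith [ht.2]⟩

/-- `t ∈ [−1,1] ⇒ λt ∈ [−λ,λ]`. [folklore] -/
private theorem mul_mem_Icc_of_mem_Icc (hlam : 0 < lam) {t : ℝ} (ht : t ∈ Icc (-1 : ℝ) 1) :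
    lam * t ∈ Icc (-lam) lam := ⟨by nlinarith [ht.1], by nlinarith [ht.2]⟩

/-- **The tree's prolate function, rescaled to `[−1,1]`, is a unit-interval prolate datum** with
`χ` unchanged, `q = (2πλ²)²/χ` (bandwidth `c = 2πλ²`), provided `(2πλ²)² < χ` (`q < 1`).
[cite: BonamiKaroui2014, §1 eq. (1); WangLL2010, eq. (2.1) (the substitution `x = λt`)] -/
theorem _root_.Literature.NumberTheory.LFunctions.IsProlateFunction.isUnitPSWF_rescale
    (hf : IsProlateFunction lam n f) {χ : ℝ}
    (hχ : ∀ x ∈ Ioo (-lam) lam,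
      -(deriv (fun y ↦ (lam ^ 2 - y ^ 2) * deriv f y) x) + (2 * π * lam * x) ^ 2 * f x = χ * f x)
    (hq : (2 * π * lam ^ 2) ^ 2 < χ) :
    IsUnitPSWF χ ((2 * π * lam ^ 2) ^ 2 / χ) n (rescale lam f) (rescaleDeriv lam f) := by
  have hlam := hf.lam_pos
  have hc0 : 0 < (2 * π * lam ^ 2) ^ 2 := by positivity
  have hχ0 : 0 < χ := hc0.trans hq
  have hsl : 0 < Real.sqrt lam := Real.sqrt_pos.2 hlam
  have hmul : Continuous fun t : ℝ ↦ lam * t := continuous_const.mul continuous_id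
  refine ⟨hχ0, (div_pos hc0 hχ0).le, (div_lt_one hχ0).2 hq, ?_, ?_, ?_, ?_, ?_, ?_⟩
  · -- continuity of `g`
    exact continuousOn_const.mul (hf.contDiffOn.continuousOn.comp hmul.continuousOn
      fun t ht ↦ mul_mem_Icc_of_mem_Icc hlam ht)
  · -- continuity of `g₁`
    refine continuousOn_const.mul ((hf.continuousOn_derivWithin.comp hmul.continuousOn
      fun t ht ↦ mul_mem_Icc_of_mem_Icc hlam ht).mul continuousOn_const)
  · -- `g′ = g₁`
    intro t ht
    have h := (hf.hasDerivAt_derivWithin (mul_mem_Ioo_of_mem_Ioo hlam ht)).comp t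
      ((hasDerivAt_id t).const_mul lam)
    have h' := h.const_mul (Real.sqrt lam)
    refine (h'.congr_of_eventuallyEq (Eventually.of_forall fun y ↦ rfl)).congr_deriv ?_
    simp [rescaleDeriv]
  · -- the flux equation
    intro t ht
    have hx := mul_mem_Ioo_of_mem_Ioo hlam ht
    have h := ((hf.hasDerivAt_flux hχ hx).comp t ((hasDerivAt_id t).const_mul lam)).const_mul
      (Real.sqrt lam / lam)
    have heq : (fun y ↦ (1 - y ^ 2) * rescaleDeriv lam f y) =
        fun y ↦ Real.sqrt lam / lam * ((lam ^ 2 - (lam * y) ^ 2) *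
          derivWithin f (Icc (-lam) lam) (lam * y)) := by
      funext y
      simp only [rescaleDeriv]
      field_simp
    rw [heq]
    refine (h.congr_of_eventuallyEq (Eventually.of_forall fun y ↦ by simp)).congr_deriv ?_
    simp only [rescale, rho, mul_one]
    field_simp
    ring
  · -- finiteness of the zero set
    have heq : {t : ℝ | t ∈ Ioo (-1 : ℝ) 1 ∧ rescale lam f t = 0} =
        (fun x ↦ x / lam) '' {x : ℝ | x ∈ Ioo (-lam) lam ∧ f x = 0} := by
      ext t
      simp only [mem_setOf_eq, mem_image, rescale, mul_eq_zero, hsl.ne', false_or]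
      constructor
      · rintro ⟨ht, h0⟩
        exact ⟨lam * t, ⟨mul_mem_Ioo_of_mem_Ioo hlam ht, h0⟩, by field_simp⟩
      · rintro ⟨x, ⟨hx, hx0⟩, rfl⟩
        refine ⟨⟨?_, ?_⟩, ?_⟩
        · rw [lt_div_iff₀ hlam]; linarith [hx.1]
        · rw [div_lt_iff₀ hlam]; linarith [hx.2]
        · rwa [mul_div_cancel₀ _ hlam.ne']
    rw [heq]
    exact hf.zeros_finite.image _
  · have heq : {t : ℝ | t ∈ Ioo (-1 : ℝ) 1 ∧ rescale lam f t = 0} =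
        (fun x ↦ x / lam) '' {x : ℝ | x ∈ Ioo (-lam) lam ∧ f x = 0} := by
      ext t
      simp only [mem_setOf_eq, mem_image, rescale, mul_eq_zero, hsl.ne', false_or]
      constructor
      · rintro ⟨ht, h0⟩
        exact ⟨lam * t, ⟨mul_mem_Ioo_of_mem_Ioo hlam ht, h0⟩, by field_simp⟩
      · rintro ⟨x, ⟨hx, hx0⟩, rfl⟩
        refine ⟨⟨?_, ?_⟩, ?_⟩
        · rw [lt_div_iff₀ hlam]; linarith [hx.1]
        · rw [div_lt_iff₀ hlam]; linarith [hx.2]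
        · rwa [mul_div_cancel₀ _ hlam.ne']
    have hinj : Function.Injective (fun x : ℝ ↦ x / lam) := fun a b hab ↦ by
      simpa [div_left_inj' hlam.ne'] using hab
    rw [heq, Set.ncard_image_of_injective _ hinj, hf.zeros_card]

/-- `‖g‖²_{L²[−1,1]} = ‖f‖²_{L²[−λ,λ]} = 1` for the rescaled prolate function.
[cite: BonamiKaroui2014, §1 («normalized so that their L²([−1,1]) norm is equal to 1»)] -/
theorem _root_.Literature.NumberTheory.LFunctions.IsProlateFunction.integral_rescale_sq
    (hf : IsProlateFunction lam n f) :
    ∫ t in (-1 : ℝ)..1, rescale lam f t ^ 2 = 1 := by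
  have hlam := hf.lam_pos
  have h1 : ∀ t, rescale lam f t ^ 2 = lam * (fun x ↦ f x ^ 2) (lam * t) := by
    intro t; simp only [rescale]; rw [mul_pow, Real.sq_sqrt hlam.le]
  simp_rw [h1]
  rw [intervalIntegral.integral_const_mul]
  have h2 : ∫ x in (-1 : ℝ)..1, f (lam * x) ^ 2 = lam⁻¹ * ∫ x in (-lam)..lam, f x ^ 2 := by
    have := intervalIntegral.integral_comp_mul_left (fun x ↦ f x ^ 2) (a := -1) (b := 1) hlam.ne'
    simpa using this
  rw [h2, hf.norm_one]
  field_simp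

/-- `g(1) = λ^{1/2} f(λ)`. [folklore] -/
private theorem rescale_one (lam : ℝ) (f : ℝ → ℝ) : rescale lam f 1 = Real.sqrt lam * f lam := by
  simp [rescale]

/-- **Osipov's bound for the tree's prolate functions** `h_{n,λ}` (`IsProlateFunction lam n f`,
bandwidth `c = 2πλ²`): if the eigenvalue exceeds `c²`, then `χ < (π(n+1)/2)²`.
[cite: Osipov2013, Thm. 8; Osipov2012Inequalities, Thm. 13] -/
theorem _root_.Literature.NumberTheory.LFunctions.IsProlateFunction.eigen_lt_sq_of_sq_lt_eigen
    (hf : IsProlateFunction lam n f) {χ : ℝ}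
    (hχ : ∀ x ∈ Ioo (-lam) lam,
      -(deriv (fun y ↦ (lam ^ 2 - y ^ 2) * deriv f y) x) + (2 * π * lam * x) ^ 2 * f x = χ * f x)
    (hq : (2 * π * lam ^ 2) ^ 2 < χ) :
    χ < (π * (n + 1) / 2) ^ 2 :=
  chi_lt_of_isUnitPSWF (hf.isUnitPSWF_rescale hχ hq)

end rescale
end ProlateLiouville

end Literature.NumberTheory.LFunctions

end
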